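import Literature.RepresentationTheory.MoeglinVignerasWaldspurger1987.RankOneThetaLiftLinesDisjoint
import HarnessLib

/-!
# The `(ε, χ)`-clauses of [Liu2021, App. D Lem. D.1 (3)] (→ direction) at `n = 3`, non-split place — from row IV-4c1

Topic `RepresentationTheory/MoeglinVignerasWaldspurger1987`; THEOREMS ONLY (no definition, no named fact, no `sorry`).
Companion of `RankOneThetaLiftLinesDisjoint.lean` (named fact IV-4c1 `rankOne_theta_lines_disjoint`, the `ε`-clause as a
`False`-statement for two lines in different classes) and `RankOneThetaLiftCentralCharacter.lean` (the `χ`-clause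
`rankOne_thetaChar_eq_of_areIsomorphicRep`, PROVED — but for ONE section `s` only).

WHAT IS PROVED HERE, in the section currency of those files (`ω_s := (MpPsi.toRep (localSchrodinger F N T v)).comp s`,
`Θ_s(χ) := TwistedCoinv.rep χ ω_s _` on the `χ`-coinvariants of `ω_s` under the centre `localCenter`):

* §1 (generic, namespace `Literature.RepresentationTheory.TwistedCoinv`) `char_eq_of_linearEquiv₂` — the central
  character is an invariant of the coinvariant representation ACROSS TWO acting pairs `(ρV₁, ρW₁)` on `S₁` and
  `(ρV₂, ρW₂)` on `S₂` through which a common `ζ : H → G` acts (`ρVᵢ (ζ w) = ρWᵢ w`): an equivariant (for the `ζ w`)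
  linear equivalence `Coinv ρW₁ χ₁ ≃ Coinv ρW₂ χ₂` with `Coinv ρW₁ χ₁ ≠ 0` forces `χ₁ = χ₂` (p593978's
  `char_eq_of_linearEquiv` is the case `S₁ = S₂`, `ρV₁ = ρV₂`, `ρW₁ = ρW₂`).
* §2 `rankOne_thetaChar_eq_of_areIsomorphicRep₂` — **`Θ_{s₁}(χ₁) ≅ Θ_{s₂}(χ₂) ≠ 0 ⇒ χ₁ = χ₂` for ANY two
  homomorphisms `s₁, s₂ : U(J)(F_v) →* S̃p_ψ`** (any `N`): the `χ`-clause of [Liu2021, Lem. D.1 (3)] across different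
  `(μ, ε)` (two members of a family have different splittings), by central characters.
* §3 `rankOne_theta_epsClass_and_char_eq_of_areIsomorphicRep` — **the `(ε, χ)`-clauses of Lem. D.1 (3), → direction,
  at `n = 3` and a non-split `v`, CONDITIONAL on the named fact IV-4c1** (`h : rankOne_theta_lines_disjoint`, D-0014):
  with the binders of that fact verbatim (minus its class hypothesis), `Θ_{s₁}(χ₁) ≠ 0` and
  `Θ_{s₁}(χ₁) ≅ Θ_{s₂}(χ₂)` give (i) the two representatives `ε₁ = δ₁ ⊗ 1`, `ε₂ = δ₂ ⊗ 1` are in the SAME class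
  (`∃ x, ε₂ = x · xᶜ · ε₁`) and (ii) `χ₁ = χ₂`; `rankOne_theta_sameClass_and_char_eq_of_areIsomorphicRep` — the same with
  (i) spelled `LemD1.SameClass` at the standing data `LemD1OfPlace.standingData … hcδ₁ hδ₁ …` (the literal currency of
  `LemD1_3AsPrintedI`'s right-hand side `… ∧ LemD1.SameClass (eps i) (eps j) ∧ chi j = chi i`, via the glue
  `sameClass_eps_iff` of `RankOneThetaLiftLinesDisjoint.lean`).  The `μ`-clause (row IV-4c3 `rankOne_theta_twist_rigidity`
  + the consumer's «`s_μ = s_μ'` ⇒ `μ = μ'`») is NOT touched here.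

Nothing of [Liu2021] is asserted: Lemma D.1 (3)'s `ε`-clause enters only as the hypothesis `h : rankOne_theta_lines_disjoint`
(a `Prop`); §1–§2 are unconditional.  Cell hodgecm-mathlib, B-side derivation for the `hD3` line (a4-liuD3); HC_CM is NOT
proved here and is proved only modulo the printed citations until rung 0 closes.

## References
* [Liu2021] Y. Liu, Camb. J. Math. 9 (2021) = arXiv:2102.11518 — App. D §D.1 Step 1 (l. 5217), Lem. D.1 (3) (l. 5233)
  and its proof (l. 5255, «known when `n = 3` by [GR90, Proposition 5.1.4]»).
* [GanTakeda2015] W. T. Gan, S. Takeda, *A proof of the Howe duality conjecture*, J. AMS 29 (2016), Thm. 1.2 (ii).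
* [MoeglinVignerasWaldspurger1987] MVW, LNM 1291, Chap. 3 §IV (rank-one type I pairs; currency of this folder).
-/

noncomputable section

/-! ## §1 Generic: the central character across two acting pairs -/

namespace Literature.RepresentationTheory.TwistedCoinv

variable {k : Type*} [Field k] {G H S₁ S₂ : Type*} [Group G] [Group H] [AddCommGroup S₁] [Module k S₁]
  [AddCommGroup S₂] [Module k S₂]
variable {ρW₁ : Representation k H S₁} {ρW₂ : Representation k H S₂} (χ₁ χ₂ : H →* kˣ)
  (ρV₁ : Representation k G S₁) (ρV₂ : Representation k G S₂)

/-- **The character is an invariant of the coinvariant representation, across two acting pairs.**  Let `(ρV₁, ρW₁)`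
on `S₁` and `(ρV₂, ρW₂)` on `S₂` be commuting pairs and let `ζ : H → G` act through both (`ρVᵢ (ζ w) = ρWᵢ w` — the
common centre of a rank-one dual pair, for two splittings).  If `Coinv ρW₁ χ₁ ≠ 0` and a linear equivalence
`Coinv ρW₁ χ₁ ≃ Coinv ρW₂ χ₂` intertwines the actions of every `ζ w`, then `χ₁ = χ₂`: `ζ w` acts by `χ₁ w` on the
source and by `χ₂ w` on the target (`rep_eq_smul_of_forall`), and an equivalence has a non-zero value.
[cite: Liu2021, App. D Lemma D.1 (3) (l. 5233)] -/
theorem char_eq_of_linearEquiv₂ (hc₁ : ∀ (g : G) (h : H), Commute (ρV₁ g) (ρW₁ h))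
    (hc₂ : ∀ (g : G) (h : H), Commute (ρV₂ g) (ρW₂ h)) (ζ : H → G)
    (hζ₁ : ∀ (w : H) (v : S₁), ρV₁ (ζ w) v = ρW₁ w v) (hζ₂ : ∀ (w : H) (v : S₂), ρV₂ (ζ w) v = ρW₂ w v)
    [Nontrivial (Coinv ρW₁ χ₁)] (f : Coinv ρW₁ χ₁ ≃ₗ[k] Coinv ρW₂ χ₂)
    (hf : ∀ (w : H) (x : Coinv ρW₁ χ₁), f (rep χ₁ ρV₁ hc₁ (ζ w) x) = rep χ₂ ρV₂ hc₂ (ζ w) (f x)) : χ₁ = χ₂ := by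
  obtain ⟨x, hx⟩ := exists_ne (0 : Coinv ρW₁ χ₁)
  refine MonoidHom.ext fun w => ?_
  have h1 := hf w x
  rw [rep_eq_smul_of_forall χ₁ ρV₁ hc₁ (z := ζ w) (w := w) (c := (1 : k)) (fun v => by rw [one_smul]; exact hζ₁ w v),
    rep_eq_smul_of_forall χ₂ ρV₂ hc₂ (z := ζ w) (w := w) (c := (1 : k)) (fun v => by rw [one_smul]; exact hζ₂ w v),
    map_smul, one_mul, one_mul] at h1
  have h2 : (((χ₁ w : kˣ) : k) - ((χ₂ w : kˣ) : k)) • f x = 0 := by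
    rw [sub_smul, h1, sub_self]
  rcases smul_eq_zero.1 h2 with h3 | h3
  · exact Units.ext (sub_eq_zero.1 h3)
  · exact absurd ((LinearEquiv.map_eq_zero_iff f).1 h3) hx

end Literature.RepresentationTheory.TwistedCoinv

/-! ## §2 The `χ`-clause across two sections of the rank-one unitary pair -/

namespace Literature.RepresentationTheory.MoeglinVignerasWaldspurger1987

open NumberField IsDedekindDomain
open scoped Matrix
open Literature.RepresentationTheory.HeisenbergGroup (MpPsi)
open Literature.NumberTheory.GelbartRogawski1991.UnitaryDualPair.LocalSplitting (iota LocalMp localSchrodinger)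
open Literature.NumberTheory.Automorphic (SchwartzBruhat UnitaryGroup.localPi UnitaryGroup.localCenter UnitaryGroup.LocalRing
  UnitaryGroup.localCenter_comm UnitaryGroup.conjLocal)
open Literature.NumberTheory.Automorphic.Liu2021 (AreIsomorphicRep LemD1.SameClass LemD1OfPlace.eps
  LemD1OfPlace.eps_mem_skew LemD1OfPlace.standingData)

/-- **`Θ_{s₁}(χ₁) ≅ Θ_{s₂}(χ₂) ≠ 0 ⇒ χ₁ = χ₂` for the rank-one pair `(U(W), U(V))`, `dim W = 1`, ACROSS TWO SECTIONS**:
for ANY homomorphisms `s₁, s₂ : U(J)(F_v) →* S̃p_ψ` (e.g. splittings over the embeddings of two different lines, or of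
two Kudla types), `ω_{sᵢ} := (MpPsi.toRep (localSchrodinger F N T v)) ∘ sᵢ`, the centre `U(J₁)(F_v) → U(J)(F_v)`
(`UnitaryGroup.localCenter`) and two characters `χ₁, χ₂` of `U(J₁)(F_v) = E_v¹`: if the `χ₁`-coinvariants of `ω_{s₁}`
are non-zero and `Θ_{s₁}(χ₁) ≅ Θ_{s₂}(χ₂)` as representations of `U(J)(F_v)` (`AreIsomorphicRep`), then `χ₁ = χ₂` —
the `χ`-clause of [Liu2021, Lem. D.1 (3)] between two members with arbitrary `(μ, ε)`, by central characters (§1).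
`rankOne_thetaChar_eq_of_areIsomorphicRep` (p593978) is the case `s₁ = s₂`. [cite: Liu2021, App. D Lemma D.1 (3) (l. 5233)] -/
theorem rankOne_thetaChar_eq_of_areIsomorphicRep₂ (F : Type) [Field F] [NumberField F] (E : Type) [Field E]
    [NumberField E] [Algebra F E] (c : E ≃ₐ[F] E) (N : ℕ) (T : Matrix (Fin N) (Fin N) F)
    (J : Matrix (Fin N) (Fin N) E) (v : HeightOneSpectrum (𝓞 F))
    (s₁ s₂ : UnitaryGroup.localPi E c N J v →* LocalMp F N T v)
    (J₁ : Matrix (Fin 1) (Fin 1) E) (hJ₁ : J₁ 0 0 ≠ 0) (χ₁ χ₂ : UnitaryGroup.localPi E c 1 J₁ v →* ℂˣ)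
    (hnt : Nontrivial (TwistedCoinv.Coinv
      ((show Representation ℂ (UnitaryGroup.localPi E c 1 J₁ v) (SchwartzBruhat (Fin N → v.adicCompletion F)) from
        ((MpPsi.toRep (localSchrodinger F N T v)).comp s₁).comp (UnitaryGroup.localCenter E c N J J₁ hJ₁ v))) χ₁))
    (hiso : AreIsomorphicRep
      (TwistedCoinv.rep (ρW := show Representation ℂ (UnitaryGroup.localPi E c 1 J₁ v)
          (SchwartzBruhat (Fin N → v.adicCompletion F)) from
          ((MpPsi.toRep (localSchrodinger F N T v)).comp s₁).comp (UnitaryGroup.localCenter E c N J J₁ hJ₁ v)) χ₁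
        ((MpPsi.toRep (localSchrodinger F N T v)).comp s₁)
        (fun g z => (show Commute g (UnitaryGroup.localCenter E c N J J₁ hJ₁ v z) from
          UnitaryGroup.localCenter_comm E c N J J₁ hJ₁ v z g).map ((MpPsi.toRep (localSchrodinger F N T v)).comp s₁)))
      (TwistedCoinv.rep (ρW := show Representation ℂ (UnitaryGroup.localPi E c 1 J₁ v)
          (SchwartzBruhat (Fin N → v.adicCompletion F)) from
          ((MpPsi.toRep (localSchrodinger F N T v)).comp s₂).comp (UnitaryGroup.localCenter E c N J J₁ hJ₁ v)) χ₂
        ((MpPsi.toRep (localSchrodinger F N T v)).comp s₂)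
        (fun g z => (show Commute g (UnitaryGroup.localCenter E c N J J₁ hJ₁ v z) from
          UnitaryGroup.localCenter_comm E c N J J₁ hJ₁ v z g).map ((MpPsi.toRep (localSchrodinger F N T v)).comp s₂)))) :
    χ₁ = χ₂ := by
  haveI := hnt
  obtain ⟨f, hf⟩ := hiso
  exact TwistedCoinv.char_eq_of_linearEquiv₂ χ₁ χ₂ ((MpPsi.toRep (localSchrodinger F N T v)).comp s₁)
    ((MpPsi.toRep (localSchrodinger F N T v)).comp s₂) _ _
    (UnitaryGroup.localCenter E c N J J₁ hJ₁ v) (fun _ _ => rfl) (fun _ _ => rfl) f (fun w x => hf _ x)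

/-! ## §3 The `(ε, χ)`-clauses at `n = 3`, non-split `v`, conditional on row IV-4c1 -/

/-- **[Liu2021, App. D Lem. D.1 (3)], `(ε, χ)`-clauses, → direction, at `n = 3` and a NON-SPLIT place — CONDITIONAL on the
named fact IV-4c1 `rankOne_theta_lines_disjoint`** (hypothesis `h`; D-0014), READ AT THE TREE'S OBJECTS with the binders
of that fact verbatim: `F` a number field, `E/F` quadratic, `c`, two trace-zero `δ₁, δ₂ ≠ 0` (`c δᵢ = -δᵢ`, `δᵢ² = dᵢ`)
with local representatives `εᵢ = δᵢ ⊗ 1 ∈ E_vˣ` (`LemD1OfPlace.eps`), `T ∈ M₃(F)` symmetric with `det T` a unit, `J = T ⊗ 1`,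
a finite place `v` with `E_v` a field, splittings `s₁` over `ι_{δ₁}` and `s₂` over `ι_{δ₂}` with `ω_{sᵢ}` smooth, a
hermitian line `J₁`, unitary continuous characters `χ₁, χ₂` of `U(J₁)(F_v) = E_v¹`.  IF the `χ₁`-coinvariants of
`ω_{s₁}` under the centre are non-zero and `Θ_{s₁}(χ₁) ≅ Θ_{s₂}(χ₂)` as representations of `U(J)(F_v)`
(`AreIsomorphicRep`), THEN (i) `ε₁`, `ε₂` lie in the SAME class of `E_v^{−×}/Nm E_vˣ` — `∃ x, ε₂ = x · xᶜ · ε₁`,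
`xᶜ = conjLocal x` (the contrapositive of the fact) — and (ii) `χ₁ = χ₂` (central characters,
`rankOne_thetaChar_eq_of_areIsomorphicRep₂`; unconditional).  «(3) If `n ≥ 3`, then `ω(μ', ε', χ')` is isomorphic to
`ω(μ, ε, χ)` if and only if `(μ', ε', χ') = (μ, ε, χ)`» (l. 5233) — the `ε`- and `χ`-coordinates; the `μ`-coordinate is
row IV-4c3 and is not touched. [cite: Liu2021, App. D Lemma D.1 (3) (l. 5233) and proof l. 5255 (= GelbartRogawski1990 Prop. 5.1.4, n = 3)] -/
theorem rankOne_theta_epsClass_and_char_eq_of_areIsomorphicRep (h : rankOne_theta_lines_disjoint)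
    (F : Type) [Field F] [NumberField F] (E : Type) [Field E] [NumberField E] [Algebra F E]
    [Algebra.IsQuadraticExtension F E] (c : E ≃ₐ[F] E)
    (δ₁ : E) (hcδ₁ : c δ₁ = -δ₁) (hδ₁ : δ₁ ≠ 0) (d₁ : F) (hd₁ : δ₁ * δ₁ = algebraMap F E d₁)
    (δ₂ : E) (hcδ₂ : c δ₂ = -δ₂) (hδ₂ : δ₂ ≠ 0) (d₂ : F) (hd₂ : δ₂ * δ₂ = algebraMap F E d₂)
    (T : Matrix (Fin 3) (Fin 3) F) (hT : T.IsSymm) (hTd : IsUnit T.det)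
    (J : Matrix (Fin 3) (Fin 3) E) (hJ : J = T.map (algebraMap F E)) (v : HeightOneSpectrum (𝓞 F))
    (hE : IsField (UnitaryGroup.LocalRing E v))
    (s₁ s₂ : UnitaryGroup.localPi E c 3 J v →* LocalMp F 3 T v)
    (hs₁ : ∀ g, MpPsi.proj _ (s₁ g) = iota F E c 3 hcδ₁ hδ₁ hd₁ T hT hJ v g)
    (hs₂ : ∀ g, MpPsi.proj _ (s₂ g) = iota F E c 3 hcδ₂ hδ₂ hd₂ T hT hJ v g)
    (hsm₁ : Representation.IsSmooth ((MpPsi.toRep (localSchrodinger F 3 T v)).comp s₁))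
    (hsm₂ : Representation.IsSmooth ((MpPsi.toRep (localSchrodinger F 3 T v)).comp s₂))
    (J₁ : Matrix (Fin 1) (Fin 1) E) (hJ₁ : J₁ 0 0 ≠ 0) (χ₁ χ₂ : UnitaryGroup.localPi E c 1 J₁ v →* ℂˣ)
    (hχ₁u : ∀ z, ‖((χ₁ z : ℂˣ) : ℂ)‖ = 1) (hχ₁c : Continuous fun z => ((χ₁ z : ℂˣ) : ℂ))
    (hχ₂u : ∀ z, ‖((χ₂ z : ℂˣ) : ℂ)‖ = 1) (hχ₂c : Continuous fun z => ((χ₂ z : ℂˣ) : ℂ))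
    (hnt : Nontrivial (TwistedCoinv.Coinv
      ((show Representation ℂ (UnitaryGroup.localPi E c 1 J₁ v) (SchwartzBruhat (Fin 3 → v.adicCompletion F)) from
        ((MpPsi.toRep (localSchrodinger F 3 T v)).comp s₁).comp (UnitaryGroup.localCenter E c 3 J J₁ hJ₁ v))) χ₁))
    (hiso : AreIsomorphicRep
      (TwistedCoinv.rep
        (ρW := show Representation ℂ (UnitaryGroup.localPi E c 1 J₁ v) (SchwartzBruhat (Fin 3 → v.adicCompletion F)) from
          ((MpPsi.toRep (localSchrodinger F 3 T v)).comp s₁).comp (UnitaryGroup.localCenter E c 3 J J₁ hJ₁ v))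
        χ₁ ((MpPsi.toRep (localSchrodinger F 3 T v)).comp s₁)
        (fun g z => (show Commute g (UnitaryGroup.localCenter E c 3 J J₁ hJ₁ v z) from
          UnitaryGroup.localCenter_comm E c 3 J J₁ hJ₁ v z g).map ((MpPsi.toRep (localSchrodinger F 3 T v)).comp s₁)))
      (TwistedCoinv.rep
        (ρW := show Representation ℂ (UnitaryGroup.localPi E c 1 J₁ v) (SchwartzBruhat (Fin 3 → v.adicCompletion F)) from
          ((MpPsi.toRep (localSchrodinger F 3 T v)).comp s₂).comp (UnitaryGroup.localCenter E c 3 J J₁ hJ₁ v))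
        χ₂ ((MpPsi.toRep (localSchrodinger F 3 T v)).comp s₂)
        (fun g z => (show Commute g (UnitaryGroup.localCenter E c 3 J J₁ hJ₁ v z) from
          UnitaryGroup.localCenter_comm E c 3 J J₁ hJ₁ v z g).map ((MpPsi.toRep (localSchrodinger F 3 T v)).comp s₂)))) :
    (∃ x : (UnitaryGroup.LocalRing E v)ˣ,
      LemD1OfPlace.eps E v hδ₂ = x * Units.map (UnitaryGroup.conjLocal E c v : UnitaryGroup.LocalRing E v →* UnitaryGroup.LocalRing E v) x *
        LemD1OfPlace.eps E v hδ₁) ∧ χ₁ = χ₂ := by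
  refine ⟨?_, rankOne_thetaChar_eq_of_areIsomorphicRep₂ F E c 3 T J v s₁ s₂ J₁ hJ₁ χ₁ χ₂ hnt hiso⟩
  by_contra hcls
  exact h F E c δ₁ hcδ₁ hδ₁ d₁ hd₁ δ₂ hcδ₂ hδ₂ d₂ hd₂ T hT hTd J hJ v hE hcls s₁ s₂ hs₁ hs₂ hsm₁ hsm₂ J₁ hJ₁ χ₁ χ₂
    hχ₁u hχ₁c hχ₂u hχ₂c hnt hiso

/-- **The same, with the `ε`-conjunct in the literal currency of `LemD1_3AsPrintedI`** (`… ∧ LemD1.SameClass (eps i)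
(eps j) ∧ chi j = chi i`): for the standing data `LemD1OfPlace.standingData E v c 3 J hcδ₁ hδ₁ …` at `v` (`J` hermitian,
`det J ≠ 0`) and the two Step-1 representatives `⟨ε₁, _⟩, ⟨ε₂, _⟩ ∈ EpsRep`, under `h : rankOne_theta_lines_disjoint`:
`Θ_{s₁}(χ₁) ≠ 0` and `Θ_{s₁}(χ₁) ≅ Θ_{s₂}(χ₂)` give `LemD1.SameClass ⟨ε₁, _⟩ ⟨ε₂, _⟩` (READING L3′, one unfold — the glue
`sameClass_eps_iff` is `Iff.rfl`) and `χ₁ = χ₂`. [cite: Liu2021, App. D Lemma D.1 (3) (l. 5233) and §D.1 Step 1 (l. 5217)] -/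
theorem rankOne_theta_sameClass_and_char_eq_of_areIsomorphicRep (h : rankOne_theta_lines_disjoint)
    (F : Type) [Field F] [NumberField F] (E : Type) [Field E] [NumberField E] [Algebra F E]
    [Algebra.IsQuadraticExtension F E] (c : E ≃ₐ[F] E)
    (δ₁ : E) (hcδ₁ : c δ₁ = -δ₁) (hδ₁ : δ₁ ≠ 0) (d₁ : F) (hd₁ : δ₁ * δ₁ = algebraMap F E d₁)
    (δ₂ : E) (hcδ₂ : c δ₂ = -δ₂) (hδ₂ : δ₂ ≠ 0) (d₂ : F) (hd₂ : δ₂ * δ₂ = algebraMap F E d₂)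
    (T : Matrix (Fin 3) (Fin 3) F) (hT : T.IsSymm) (hTd : IsUnit T.det)
    (J : Matrix (Fin 3) (Fin 3) E) (hJ : J = T.map (algebraMap F E)) (hJh : (J.map c)ᵀ = J) (hJdet : J.det ≠ 0)
    (v : HeightOneSpectrum (𝓞 F)) (hE : IsField (UnitaryGroup.LocalRing E v))
    (s₁ s₂ : UnitaryGroup.localPi E c 3 J v →* LocalMp F 3 T v)
    (hs₁ : ∀ g, MpPsi.proj _ (s₁ g) = iota F E c 3 hcδ₁ hδ₁ hd₁ T hT hJ v g)
    (hs₂ : ∀ g, MpPsi.proj _ (s₂ g) = iota F E c 3 hcδ₂ hδ₂ hd₂ T hT hJ v g)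
    (hsm₁ : Representation.IsSmooth ((MpPsi.toRep (localSchrodinger F 3 T v)).comp s₁))
    (hsm₂ : Representation.IsSmooth ((MpPsi.toRep (localSchrodinger F 3 T v)).comp s₂))
    (J₁ : Matrix (Fin 1) (Fin 1) E) (hJ₁ : J₁ 0 0 ≠ 0) (χ₁ χ₂ : UnitaryGroup.localPi E c 1 J₁ v →* ℂˣ)
    (hχ₁u : ∀ z, ‖((χ₁ z : ℂˣ) : ℂ)‖ = 1) (hχ₁c : Continuous fun z => ((χ₁ z : ℂˣ) : ℂ))
    (hχ₂u : ∀ z, ‖((χ₂ z : ℂˣ) : ℂ)‖ = 1) (hχ₂c : Continuous fun z => ((χ₂ z : ℂˣ) : ℂ))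
    (hnt : Nontrivial (TwistedCoinv.Coinv
      ((show Representation ℂ (UnitaryGroup.localPi E c 1 J₁ v) (SchwartzBruhat (Fin 3 → v.adicCompletion F)) from
        ((MpPsi.toRep (localSchrodinger F 3 T v)).comp s₁).comp (UnitaryGroup.localCenter E c 3 J J₁ hJ₁ v))) χ₁))
    (hiso : AreIsomorphicRep
      (TwistedCoinv.rep
        (ρW := show Representation ℂ (UnitaryGroup.localPi E c 1 J₁ v) (SchwartzBruhat (Fin 3 → v.adicCompletion F)) from
          ((MpPsi.toRep (localSchrodinger F 3 T v)).comp s₁).comp (UnitaryGroup.localCenter E c 3 J J₁ hJ₁ v))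
        χ₁ ((MpPsi.toRep (localSchrodinger F 3 T v)).comp s₁)
        (fun g z => (show Commute g (UnitaryGroup.localCenter E c 3 J J₁ hJ₁ v z) from
          UnitaryGroup.localCenter_comm E c 3 J J₁ hJ₁ v z g).map ((MpPsi.toRep (localSchrodinger F 3 T v)).comp s₁)))
      (TwistedCoinv.rep
        (ρW := show Representation ℂ (UnitaryGroup.localPi E c 1 J₁ v) (SchwartzBruhat (Fin 3 → v.adicCompletion F)) from
          ((MpPsi.toRep (localSchrodinger F 3 T v)).comp s₂).comp (UnitaryGroup.localCenter E c 3 J J₁ hJ₁ v))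
        χ₂ ((MpPsi.toRep (localSchrodinger F 3 T v)).comp s₂)
        (fun g z => (show Commute g (UnitaryGroup.localCenter E c 3 J J₁ hJ₁ v z) from
          UnitaryGroup.localCenter_comm E c 3 J J₁ hJ₁ v z g).map ((MpPsi.toRep (localSchrodinger F 3 T v)).comp s₂)))) :
    LemD1.SameClass (S := LemD1OfPlace.standingData E v c 3 J hcδ₁ hδ₁ (by norm_num) hJh hJdet)
        ⟨LemD1OfPlace.eps E v hδ₁, LemD1OfPlace.eps_mem_skew E v c 3 J hcδ₁ hδ₁ (by norm_num) hJh hJdet⟩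
        ⟨LemD1OfPlace.eps E v hδ₂, eps_mem_skew_of E v c 3 J hcδ₁ hδ₁ (by norm_num) hJh hJdet hδ₂ hcδ₂⟩ ∧
      χ₁ = χ₂ := by
  obtain ⟨hε, hχ⟩ := rankOne_theta_epsClass_and_char_eq_of_areIsomorphicRep h F E c δ₁ hcδ₁ hδ₁ d₁ hd₁ δ₂ hcδ₂ hδ₂
    d₂ hd₂ T hT hTd J hJ v hE s₁ s₂ hs₁ hs₂ hsm₁ hsm₂ J₁ hJ₁ χ₁ χ₂ hχ₁u hχ₁c hχ₂u hχ₂c hnt hiso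
  exact ⟨(sameClass_eps_iff E v c 3 J hcδ₁ hδ₁ (by norm_num) hJh hJdet hδ₂ hcδ₂).2 hε, hχ⟩

end Literature.RepresentationTheory.MoeglinVignerasWaldspurger1987

end
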